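import Mathlib
import HarnessLib
import Literature.Geometry.DiscreteGeometry.KissingPatterns
import Literature.Geometry.DiscreteGeometry.KissingRigidity
import Summits.AtomisticToContinuum.Crystallization.Theorems.PricedLinkCensusSoftLayerPropagationStubLinkEdges
import Summits.AtomisticToContinuum.Crystallization.Theorems.PricedLinkCensusSoftLayerPropagationStubChartAssembly

/-!
# Squares of the FCC and HCP kissing patterns: the integer tables (crux `SoftLayerPropagation`, line `Sketch`)

Route `PricedLinkCensus`, crux `SoftLayerPropagation` (stmt-AtomisticToContinuum-14233), line
`Sketch`, helper file for the stubs `develop_HX_fcc` / `develop_HX_hcp` (local no-merge at a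
charted site): the purely combinatorial facts about the SQUARE FACES of the cuboctahedron
(`fccInt`, contact `|v − w|² = 2`) and of the anticuboctahedron (`hcpInt`, contact `|v − w|² = 18`)
that the FAR APEX LEMMA (`…HXApex.lean`) and the case analysis of `develop_HX_fcc` consume.

* fourth corner (`…_fourth_corner`): two contacts `q, r` of `p` at squared distance `2N` span a
  square face with `p`; its fourth corner is `q + r − p`, a pattern point in contact with `q, r`
  and at squared distance `2N` from `p`;
* induced `4`-cycles are square faces (`…_cycle_four`): `u ~ a ~ k ~ b ~ u` with `u, k` and `a, b`
  distinct non-contacts forces `|u − k|² = |a − b|² = 2N`;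
* two candidates (`…_two_candidates`): if `o_u ~ o_x ~ o_k` with `|o_u − o_k|² = 2N`, `o_z ~ o_k`
  and `o_z' ~ o_u` with `|o_z − o_x|² = |o_z' − o_x|² = 2N`, then `o_z ~ o_u` or `o_z' ~ o_k`
  (the edge `{o_x, o_k}` of the anticuboctahedron may lie in two squares, so one candidate alone
  does not suffice);
* FCC only: a pair of distinct non-contacts is a square diagonal (`4`), a hexagon-opposite pair
  (`6`) or antipodal (`8`), with the pattern points around it that the metric arguments use
  (`fccInt_noncontact_cases`, `fccInt_antipodal`, `fccInt_square`, `fccInt_hexagon`).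

Everything is a `decide` over the two twelve-element tables (quantifiers interleaved with their
guards), followed by the transfer to the real patterns `scaledPattern S N` (`pattern_fourth_corner`,
`pattern_cycle_four`, `pattern_two_candidates`).  All `[folklore]` (elementary geometry of the
cuboctahedron and the anticuboctahedron, cf. HalesDSP2012 §1.3).
-/

namespace Summit.AtomisticToContinuum.Crystallization.Theorems

open Literature.Geometry.DiscreteGeometry

set_option maxRecDepth 8000
set_option synthInstance.maxSize 8192
set_option synthInstance.maxHeartbeats 800000

/-! ### FCC (`N = 2`) -/

/-- FCC, fourth corner of a square: contacts `q, r` of `p` with `|q − r|² = 4` give the pattern point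
`q + r − p`, in contact with `q` and `r`, at squared distance `4` from `p`. [folklore] -/
theorem fccInt_fourth_corner : ∀ p ∈ fccInt, ∀ q ∈ fccInt, sqNormInt (p - q) = (2 : ℕ) → ∀ r ∈ fccInt,
    sqNormInt (p - r) = (2 : ℕ) → sqNormInt (q - r) = 2 * (2 : ℕ) →
    q + r - p ∈ fccInt ∧ sqNormInt (q + r - p - q) = (2 : ℕ) ∧ sqNormInt (q + r - p - r) = (2 : ℕ) ∧
      sqNormInt (q + r - p - p) = 2 * (2 : ℕ) := by
  decide

/-- FCC, induced `4`-cycles of the contact graph are square faces: both diagonals have squared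
length `4`. [folklore] -/
theorem fccInt_cycle_four : ∀ u ∈ fccInt, ∀ a ∈ fccInt, sqNormInt (u - a) = (2 : ℕ) → ∀ k ∈ fccInt,
    sqNormInt (a - k) = (2 : ℕ) → u ≠ k → sqNormInt (u - k) ≠ (2 : ℕ) → ∀ b ∈ fccInt,
    sqNormInt (k - b) = (2 : ℕ) → sqNormInt (b - u) = (2 : ℕ) → a ≠ b → sqNormInt (a - b) ≠ (2 : ℕ) →
    sqNormInt (u - k) = 2 * (2 : ℕ) ∧ sqNormInt (a - b) = 2 * (2 : ℕ) := by
  decide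

/-- FCC, two candidates for the far corner: `o_u ~ o_x ~ o_k` with `|o_u − o_k|² = 4`, `o_z ~ o_k`,
`o_z' ~ o_u`, `|o_z − o_x|² = |o_z' − o_x|² = 4` force `o_z ~ o_u` or `o_z' ~ o_k`. [folklore] -/
theorem fccInt_two_candidates : ∀ ox ∈ fccInt, ∀ ou ∈ fccInt, sqNormInt (ou - ox) = (2 : ℕ) →
    ∀ ok ∈ fccInt, sqNormInt (ok - ox) = (2 : ℕ) → sqNormInt (ou - ok) = 2 * (2 : ℕ) →
    ∀ oz ∈ fccInt, sqNormInt (oz - ox) = 2 * (2 : ℕ) → sqNormInt (oz - ok) = (2 : ℕ) →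
    ∀ oz' ∈ fccInt, sqNormInt (oz' - ox) = 2 * (2 : ℕ) → sqNormInt (oz' - ou) = (2 : ℕ) →
    sqNormInt (oz - ou) = (2 : ℕ) ∨ sqNormInt (oz' - ok) = (2 : ℕ) := by
  decide

/-- FCC: two distinct non-contacts are a square diagonal (`4`), hexagon-opposite (`6`) or antipodal
(`8`). [folklore] -/
theorem fccInt_noncontact_cases : ∀ v ∈ fccInt, ∀ w ∈ fccInt, v ≠ w → sqNormInt (v - w) ≠ (2 : ℕ) →
    sqNormInt (v - w) = 4 ∨ sqNormInt (v - w) = 6 ∨ sqNormInt (v - w) = 8 := by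
  decide

/-- FCC: squared distance `8` means antipodal. [folklore] -/
theorem fccInt_antipodal : ∀ v ∈ fccInt, ∀ w ∈ fccInt, sqNormInt (v - w) = 8 → w = -v := by
  decide

/-- FCC: a square diagonal `v, w` has two common contacts `a, b`, themselves a square diagonal.
[folklore] -/
theorem fccInt_square : ∀ v ∈ fccInt, ∀ w ∈ fccInt, sqNormInt (v - w) = 4 →
    ∃ a ∈ fccInt, sqNormInt (v - a) = (2 : ℕ) ∧ sqNormInt (a - w) = (2 : ℕ) ∧
      ∃ b ∈ fccInt, sqNormInt (w - b) = (2 : ℕ) ∧ sqNormInt (b - v) = (2 : ℕ) ∧ a ≠ b ∧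
        sqNormInt (a - b) ≠ (2 : ℕ) := by
  decide

/-- FCC: around a hexagon-opposite pair `u, k` (`|u − k|² = 6`): the common contact `w`, the third
vertices `p` (of the triangle `u w`) and `q` (of the triangle `k w`), and the fourth corners `s` of
the square `p w k` and `s'` of the square `q w u`, with the (non-)contacts the cells
`{u,w,p}`, `{p,w,k,s}`, `{k,w,q}`, `{q,w,u,s'}` consist of. [folklore] -/
theorem fccInt_hexagon : ∀ u ∈ fccInt, ∀ k ∈ fccInt, sqNormInt (u - k) = 6 →
    ∃ w ∈ fccInt, sqNormInt (w - u) = (2 : ℕ) ∧ sqNormInt (w - k) = (2 : ℕ) ∧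
    ∃ p ∈ fccInt, sqNormInt (p - u) = (2 : ℕ) ∧ sqNormInt (p - w) = (2 : ℕ) ∧
      sqNormInt (p - k) ≠ (2 : ℕ) ∧ p ≠ k ∧
    ∃ s ∈ fccInt, sqNormInt (s - p) = (2 : ℕ) ∧ sqNormInt (k - s) = (2 : ℕ) ∧
      sqNormInt (w - s) ≠ (2 : ℕ) ∧ w ≠ s ∧
    ∃ q ∈ fccInt, sqNormInt (q - k) = (2 : ℕ) ∧ sqNormInt (q - w) = (2 : ℕ) ∧
      sqNormInt (q - u) ≠ (2 : ℕ) ∧ q ≠ u ∧ p ≠ q ∧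
    ∃ s' ∈ fccInt, sqNormInt (s' - q) = (2 : ℕ) ∧ sqNormInt (u - s') = (2 : ℕ) ∧
      sqNormInt (w - s') ≠ (2 : ℕ) ∧ w ≠ s' := by
  decide

/-! ### HCP (`N = 18`) -/

/-- HCP, fourth corner of a square. [folklore] -/
theorem hcpInt_fourth_corner : ∀ p ∈ hcpInt, ∀ q ∈ hcpInt, sqNormInt (p - q) = (18 : ℕ) → ∀ r ∈ hcpInt,
    sqNormInt (p - r) = (18 : ℕ) → sqNormInt (q - r) = 2 * (18 : ℕ) →
    q + r - p ∈ hcpInt ∧ sqNormInt (q + r - p - q) = (18 : ℕ) ∧ sqNormInt (q + r - p - r) = (18 : ℕ) ∧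
      sqNormInt (q + r - p - p) = 2 * (18 : ℕ) := by
  decide

/-- HCP, induced `4`-cycles of the contact graph are square faces. [folklore] -/
theorem hcpInt_cycle_four : ∀ u ∈ hcpInt, ∀ a ∈ hcpInt, sqNormInt (u - a) = (18 : ℕ) → ∀ k ∈ hcpInt,
    sqNormInt (a - k) = (18 : ℕ) → u ≠ k → sqNormInt (u - k) ≠ (18 : ℕ) → ∀ b ∈ hcpInt,
    sqNormInt (k - b) = (18 : ℕ) → sqNormInt (b - u) = (18 : ℕ) → a ≠ b → sqNormInt (a - b) ≠ (18 : ℕ) →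
    sqNormInt (u - k) = 2 * (18 : ℕ) ∧ sqNormInt (a - b) = 2 * (18 : ℕ) := by
  decide

/-- HCP, two candidates for the far corner. [folklore] -/
theorem hcpInt_two_candidates : ∀ ox ∈ hcpInt, ∀ ou ∈ hcpInt, sqNormInt (ou - ox) = (18 : ℕ) →
    ∀ ok ∈ hcpInt, sqNormInt (ok - ox) = (18 : ℕ) → sqNormInt (ou - ok) = 2 * (18 : ℕ) →
    ∀ oz ∈ hcpInt, sqNormInt (oz - ox) = 2 * (18 : ℕ) → sqNormInt (oz - ok) = (18 : ℕ) →
    ∀ oz' ∈ hcpInt, sqNormInt (oz' - ox) = 2 * (18 : ℕ) → sqNormInt (oz' - ou) = (18 : ℕ) →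
    sqNormInt (oz - ou) = (18 : ℕ) ∨ sqNormInt (oz' - ok) = (18 : ℕ) := by
  decide

/-! ### The package, and the transfer to the real patterns -/

/-- Both patterns: the integer model `(S, N)` behind `P ∈ {FCC, HCP}` with the three square tables.
[folklore] -/
theorem hx_squareTables : ∀ P : Finset (EuclideanSpace ℝ (Fin 3)),
    (P = Literature.Geometry.DiscreteGeometry.fccKissingPattern ∨ P = Literature.Geometry.DiscreteGeometry.hcpKissingPattern) → ∃ (S : Finset (Fin 3 → ℤ)) (N : ℕ),
    N ≠ 0 ∧ (∀ v ∈ S, Literature.Geometry.DiscreteGeometry.sqNormInt v = N) ∧ P = Literature.Geometry.DiscreteGeometry.scaledPattern S N ∧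
    (∀ p ∈ S, ∀ q ∈ S, Literature.Geometry.DiscreteGeometry.sqNormInt (p - q) = N → ∀ r ∈ S, Literature.Geometry.DiscreteGeometry.sqNormInt (p - r) = N →
      Literature.Geometry.DiscreteGeometry.sqNormInt (q - r) = 2 * N → q + r - p ∈ S ∧ Literature.Geometry.DiscreteGeometry.sqNormInt (q + r - p - q) = N ∧
        Literature.Geometry.DiscreteGeometry.sqNormInt (q + r - p - r) = N ∧ Literature.Geometry.DiscreteGeometry.sqNormInt (q + r - p - p) = 2 * N) ∧
    (∀ u ∈ S, ∀ a ∈ S, Literature.Geometry.DiscreteGeometry.sqNormInt (u - a) = N → ∀ k ∈ S, Literature.Geometry.DiscreteGeometry.sqNormInt (a - k) = N → u ≠ k →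
      Literature.Geometry.DiscreteGeometry.sqNormInt (u - k) ≠ N → ∀ b ∈ S, Literature.Geometry.DiscreteGeometry.sqNormInt (k - b) = N → Literature.Geometry.DiscreteGeometry.sqNormInt (b - u) = N → a ≠ b →
      Literature.Geometry.DiscreteGeometry.sqNormInt (a - b) ≠ N → Literature.Geometry.DiscreteGeometry.sqNormInt (u - k) = 2 * N ∧ Literature.Geometry.DiscreteGeometry.sqNormInt (a - b) = 2 * N) ∧
    (∀ ox ∈ S, ∀ ou ∈ S, Literature.Geometry.DiscreteGeometry.sqNormInt (ou - ox) = N → ∀ ok ∈ S, Literature.Geometry.DiscreteGeometry.sqNormInt (ok - ox) = N →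
      Literature.Geometry.DiscreteGeometry.sqNormInt (ou - ok) = 2 * N → ∀ oz ∈ S, Literature.Geometry.DiscreteGeometry.sqNormInt (oz - ox) = 2 * N → Literature.Geometry.DiscreteGeometry.sqNormInt (oz - ok) = N →
      ∀ oz' ∈ S, Literature.Geometry.DiscreteGeometry.sqNormInt (oz' - ox) = 2 * N → Literature.Geometry.DiscreteGeometry.sqNormInt (oz' - ou) = N →
      Literature.Geometry.DiscreteGeometry.sqNormInt (oz - ou) = N ∨ Literature.Geometry.DiscreteGeometry.sqNormInt (oz' - ok) = N) := by
  intro P hP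
  rcases hP with rfl | rfl
  · exact ⟨fccInt, 2, two_ne_zero, sqNormInt_fccInt, rfl, fccInt_fourth_corner, fccInt_cycle_four,
      fccInt_two_candidates⟩
  · exact ⟨hcpInt, 18, by norm_num, sqNormInt_hcpInt, rfl, hcpInt_fourth_corner, hcpInt_cycle_four,
      hcpInt_two_candidates⟩

/-- In a scaled integer pattern, `dist (v/√N) (w/√N) ^ 2 = 2 ↔ |v − w|² = 2N`. [folklore] -/
theorem dist_sq_scaled_intVec_eq_two_iff {N : ℕ} (hN : N ≠ 0) (v w : Fin 3 → ℤ) :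
    dist ((Real.sqrt N)⁻¹ • intVec v : EuclideanSpace ℝ (Fin 3))
        ((Real.sqrt N)⁻¹ • intVec w) ^ 2 = 2 ↔ sqNormInt (v - w) = 2 * N := by
  rw [dist_sq_scaled_intVec hN]
  have hNr : (0 : ℝ) < N := by positivity
  rw [div_eq_iff hNr.ne']
  constructor
  · intro h; exact_mod_cast h
  · intro h; exact_mod_cast h

/-- Scaling is additive: `(q + r − p)/√N = q/√N + r/√N − p/√N`. [folklore] -/
theorem scaled_intVec_add_sub (N : ℕ) (p q r : Fin 3 → ℤ) :
    ((Real.sqrt N)⁻¹ • intVec (q + r - p) : EuclideanSpace ℝ (Fin 3)) =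
      (Real.sqrt N)⁻¹ • intVec q + (Real.sqrt N)⁻¹ • intVec r - (Real.sqrt N)⁻¹ • intVec p := by
  rw [← intVec_sub, intVec_add, smul_sub, smul_add]

/-- **Fourth corner, pattern form.**  In `P ∈ {FCC, HCP}`: contacts `q, r` of `p` at squared distance
`2` span a square face of `P` through `p`, whose fourth corner `q + r − p` lies in `P`, is in contact
with `q` and `r`, and is at squared distance `2` (so not in contact, and distinct) from `p`. [folklore] -/
theorem pattern_fourth_corner {P : Finset (EuclideanSpace ℝ (Fin 3))}
    (hP : P = fccKissingPattern ∨ P = hcpKissingPattern) {p q r : EuclideanSpace ℝ (Fin 3)}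
    (hp : p ∈ P) (hq : q ∈ P) (hr : r ∈ P) (hpq : dist p q = 1) (hpr : dist p r = 1)
    (hqr : dist q r ^ 2 = 2) :
    q + r - p ∈ P ∧ dist (q + r - p) q = 1 ∧ dist (q + r - p) r = 1 ∧ dist (q + r - p) p ^ 2 = 2 ∧
      dist (q + r - p) p ≠ 1 ∧ q + r - p ≠ p := by
  obtain ⟨S, N, hN, -, rfl, hF, -, -⟩ := hx_squareTables P hP
  obtain ⟨v, hv, rfl⟩ := Finset.mem_image.1 hp
  obtain ⟨w, hw, rfl⟩ := Finset.mem_image.1 hq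
  obtain ⟨z, hz, rfl⟩ := Finset.mem_image.1 hr
  rw [dist_scaled_intVec_eq_one_iff hN] at hpq hpr
  rw [dist_sq_scaled_intVec_eq_two_iff hN] at hqr
  obtain ⟨hm, h1, h2, h3⟩ := hF v hv w hw hpq z hz hpr hqr
  rw [← scaled_intVec_add_sub]
  refine ⟨Finset.mem_image_of_mem _ hm, (dist_scaled_intVec_eq_one_iff hN _ _).2 h1,
    (dist_scaled_intVec_eq_one_iff hN _ _).2 h2, (dist_sq_scaled_intVec_eq_two_iff hN _ _).2 h3, ?_, ?_⟩
  · intro h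
    rw [dist_scaled_intVec_eq_one_iff hN] at h
    rw [h] at h3
    have : (N : ℤ) = 0 := by linarith
    exact hN (by exact_mod_cast this)
  · intro h
    have h3' := (dist_sq_scaled_intVec_eq_two_iff hN _ _).2 h3
    rw [h, dist_self] at h3'
    norm_num at h3'

/-- **Induced `4`-cycles are squares, pattern form.**  In `P ∈ {FCC, HCP}`: `u ~ a ~ k ~ b ~ u` with
`u ≠ k`, `a ≠ b` non-contacts forces `dist u k ^ 2 = dist a b ^ 2 = 2`. [folklore] -/
theorem pattern_cycle_four {P : Finset (EuclideanSpace ℝ (Fin 3))}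
    (hP : P = fccKissingPattern ∨ P = hcpKissingPattern) {u a k b : EuclideanSpace ℝ (Fin 3)}
    (hu : u ∈ P) (ha : a ∈ P) (hk : k ∈ P) (hb : b ∈ P) (hua : dist u a = 1) (hak : dist a k = 1)
    (hkb : dist k b = 1) (hbu : dist b u = 1) (huk : u ≠ k) (huk' : dist u k ≠ 1) (hab : a ≠ b)
    (hab' : dist a b ≠ 1) : dist u k ^ 2 = 2 ∧ dist a b ^ 2 = 2 := by
  obtain ⟨S, N, hN, -, rfl, -, hC, -⟩ := hx_squareTables P hP
  obtain ⟨vu, hvu, rfl⟩ := Finset.mem_image.1 hu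
  obtain ⟨va, hva, rfl⟩ := Finset.mem_image.1 ha
  obtain ⟨vk, hvk, rfl⟩ := Finset.mem_image.1 hk
  obtain ⟨vb, hvb, rfl⟩ := Finset.mem_image.1 hb
  rw [dist_scaled_intVec_eq_one_iff hN] at hua hak hkb hbu
  rw [Ne, dist_scaled_intVec_eq_one_iff hN] at huk' hab'
  have huk0 : vu ≠ vk := fun h => huk (by rw [h])
  have hab0 : va ≠ vb := fun h => hab (by rw [h])
  obtain ⟨h1, h2⟩ := hC vu hvu va hva hua vk hvk hak huk0 huk' vb hvb hkb hbu hab0 hab'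
  exact ⟨(dist_sq_scaled_intVec_eq_two_iff hN _ _).2 h1, (dist_sq_scaled_intVec_eq_two_iff hN _ _).2 h2⟩

/-- **Two candidates, pattern form.**  In `P ∈ {FCC, HCP}`: if `o_u ~ o_x ~ o_k` with
`dist o_u o_k ^ 2 = 2`, `o_z ~ o_k`, `o_z' ~ o_u` and `dist o_z o_x ^ 2 = dist o_z' o_x ^ 2 = 2`, then
`o_z ~ o_u` or `o_z' ~ o_k`. [folklore] -/
theorem pattern_two_candidates {P : Finset (EuclideanSpace ℝ (Fin 3))}
    (hP : P = fccKissingPattern ∨ P = hcpKissingPattern) {ox ou ok oz oz' : EuclideanSpace ℝ (Fin 3)}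
    (hox : ox ∈ P) (hou : ou ∈ P) (hok : ok ∈ P) (hoz : oz ∈ P) (hoz' : oz' ∈ P)
    (hux : dist ou ox = 1) (hkx : dist ok ox = 1) (huk : dist ou ok ^ 2 = 2)
    (hzx : dist oz ox ^ 2 = 2) (hzk : dist oz ok = 1) (hz'x : dist oz' ox ^ 2 = 2) (hz'u : dist oz' ou = 1) :
    dist oz ou = 1 ∨ dist oz' ok = 1 := by
  obtain ⟨S, N, hN, -, rfl, -, -, hT⟩ := hx_squareTables P hP
  obtain ⟨vx, hvx, rfl⟩ := Finset.mem_image.1 hox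
  obtain ⟨vu, hvu, rfl⟩ := Finset.mem_image.1 hou
  obtain ⟨vk, hvk, rfl⟩ := Finset.mem_image.1 hok
  obtain ⟨vz, hvz, rfl⟩ := Finset.mem_image.1 hoz
  obtain ⟨vz', hvz', rfl⟩ := Finset.mem_image.1 hoz'
  rw [dist_scaled_intVec_eq_one_iff hN] at hux hkx hzk hz'u
  rw [dist_sq_scaled_intVec_eq_two_iff hN] at huk hzx hz'x
  rcases hT vx hvx vu hvu hux vk hvk hkx huk vz hvz hzx hzk vz' hvz' hz'x hz'u with h | h
  · exact Or.inl ((dist_scaled_intVec_eq_one_iff hN _ _).2 h)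
  · exact Or.inr ((dist_scaled_intVec_eq_one_iff hN _ _).2 h)

end Summit.AtomisticToContinuum.Crystallization.Theorems
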